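import Summits.QuantumAdvantage.QuantumAdvantage.Theorems.CharDialFieldColA
import HarnessLib

/-!
# CharDial / JLinPeel — FIELD COLUMNS, part B: `fieldY` ROBUSTLY ESCAPES THE MASK DIAL (route `CharDial`, item 32604; lens-6 node g18 §10)

* ★ `field_not_mask` — GENERICITY ⇒ ROBUST MASK ESCAPE: if `α` is GENERIC at level `n` (hypothesis `hα`: no `m`-set of
  exponents, `1 ≤ m ≤ log₂ n`, has power sum `Σ_B α^(i+1)` vanishing on the first `(m+1)(log₂ n+1)` coordinates), then NO
  presentation of `fieldY p n α` with juntas `≤ log₂ n` satisfies the inlined mask-dial hypothesis of parts 31C/31F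
  (`3·p·(R+1) ≤ n`).  Mechanism: a mask system with block size `m` has `M ≥ 2^m((L+1)²+1) > (m+1)(L+1)·L` blocks and forces
  `m ≤ L`, so the flip count (part A / 31K) with the `(m+1)(L+1) ≤ R` power columns `r < (m+1)(L+1)`, each owning a full-pattern
  `u = 0`-accepting cut, yields a masked block zero-sum for all of them — i.e. a NON-generic power sum.
* ★ `exists_generic` — GENERIC ELEMENTS EXIST (`p ≥ 4`), by COUNTING: for an `m`-set `B ≠ ∅` and a target `v`, the elements `α`
  with `Σ_B α^(i+1) = v` are roots of the non-zero polynomial `Q_B − C v` of degree `≤ n` (`psPoly_sub_C_ne_zero`,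
  `card_powerSum_eq_le`); the targets with vanishing coordinates `r < R'` number `≤ p^(R − R')` (`card_lowZero_le`); the `m`-sets
  number `≤ n^m`; and `L · n^(m+1) · p^(R−(m+1)(L+1)) < p^R` because `p ≥ 4` (`count_lt`: `n < 2^(L+1)`, `L < 2^((m+1)(L+1))`);
  the `L` levels `m = 1 … L` together stay below `|GaloisField p R| = p^R` (`GaloisField.card`).
* ★★ `fieldY_not_mask` (every prime `p ≥ 5`, every `n` with `3·p·(R+1) ≤ n`) and `fieldY_not_mask_eventually` (`∃ n₀ ∀ n ≥ n₀`,
  with the junta-free canonical presentation recorded): SOME member of the family has NO `log₂ n`-junta presentation meeting the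
  mask-dial hypothesis — the first strategy family beyond the reach of all three freeze-move dials (block ⊆ null ⊆ mask, parts
  31E/31C) at the level of ROBUST (all-presentation) escape; compare part 31H: `res2Y` escapes the null dial robustly but its
  canonical presentation MEETS the mask dial.

What this is NOT (yet): membership of `fieldY` in the class of the fifth residual also needs the HIGH side and the robust
rank/sparse escapes (the constant column `R` of the table and `α ∉ {0,1}` are there for exactly that; node §10.4 (b)–(d), g19).
-/

set_option autoImplicit false

namespace Summit.QuantumAdvantage.AdviceFreeQNC0.JLinPeel.FieldCol

open Finset MaskDial BlockDial Polynomial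

/-! #### (3) GENERICITY ⇒ ROBUST MASK ESCAPE -/
section Escape
variable (p : ℕ) [hp : Fact p.Prime]

/-- ★ **GENERIC ⇒ ROBUST MASK ESCAPE.**  If `α` is generic at level `n` (`hα`), then NO presentation of `fieldY p n α` with juntas of
size `≤ log₂ n` satisfies the (inlined) mask-dial hypothesis of part 31C/31F. -/
theorem field_not_mask (n : ℕ) (hn : 3 * p * (rk n + 1) ≤ n) (α : GaloisField p (rk n))
    (hα : ∀ m : ℕ, 1 ≤ m → m ≤ Nat.log 2 n → ∀ B : Finset (Fin n), B.card = m →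
      ∃ r : Fin (rk n), r.val < (m + 1) * (Nat.log 2 n + 1) ∧ coord p n (∑ i ∈ B, α ^ (i.val + 1)) r ≠ 0)
    (D : JLinData p n) (hD : D.strat = fieldY p n α) (hJ : ∀ g, (D.J g).card ≤ Nat.log 2 n) :
    ¬ (∃ (ℓ m M : ℕ) (S : Fin M → ℕ) (Z : Finset (Fin n)), (m % 3 = 1 ∨ m % 3 = 2) ∧
        ((∀ k k' : Fin M, k < k' → S k + ℓ ≤ S k') ∧ (∀ k : Fin M, S k + ℓ ≤ n)) ∧
        (∀ k : Fin M, (zblk ℓ S Z k).card = m) ∧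
        2 ^ m * ((Nat.log 2 n + 1) * (Nat.log 2 n + 1) + 1) ≤ M ∧
          ∀ g (k : Fin M), ∑ i ∈ zblk ℓ S Z k, D.a g i = 0) := by
  rintro ⟨ℓ, m, M, S, Z, hm3, hS, hcard, hM, hmask⟩
  set L : ℕ := Nat.log 2 n with hL
  have hm1 : 1 ≤ m := by omega
  -- `m ≤ L`: the `M ≥ 2^m` blocks are disjoint and non-empty inside `Fin n`
  have hMn : M ≤ n := card_blocks_le hS hcard hm1
  have hn0 : n ≠ 0 := by
    have h1 : 0 < 3 * p * (rk n + 1) := by have := hp.out.pos; positivity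
    omega
  have h2m : 2 ^ m ≤ n := by
    have h1 : 1 ≤ (L + 1) * (L + 1) + 1 := by omega
    calc 2 ^ m = 2 ^ m * 1 := (mul_one _).symm
      _ ≤ 2 ^ m * ((L + 1) * (L + 1) + 1) := Nat.mul_le_mul_left _ h1
      _ ≤ M := hM
      _ ≤ n := hMn
  have hmL : m ≤ L := (Nat.le_log_iff_pow_le (by norm_num) hn0).2 h2m
  -- the `R' = (m+1)(L+1)` columns and their full-pattern cuts
  set R' : ℕ := (m + 1) * (L + 1) with hR'
  have hR'le : R' ≤ rk n := by
    show (m + 1) * (L + 1) ≤ (Nat.log 2 n + 1) ^ 2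
    rw [← hL, sq]
    exact Nat.mul_le_mul_right _ (by omega)
  let ι : Fin R' → Fin (rk n) := fun r => ⟨r.val, lt_of_lt_of_le r.isLt hR'le⟩
  have hRL : R' * L < M := by
    have h1 : m + 1 ≤ 2 ^ m := Nat.lt_two_pow_self
    have h2 : R' * L ≤ 2 ^ m * ((L + 1) * L) := by
      rw [hR', mul_assoc]; exact Nat.mul_le_mul_right _ h1
    have h3 : 2 ^ m * ((L + 1) * L) < 2 ^ m * ((L + 1) * (L + 1) + 1) :=
      Nat.mul_lt_mul_of_pos_left (by nlinarith) (Nat.two_pow_pos m)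
    omega
  obtain ⟨k, hk⟩ := flipCount_zero D hJ (fun r => pcol p n α (ι r)) (fun r => gcut p n hn (ι r))
    (fun r u => by rw [hD, fieldY_gcut]) hS hmask hRL
  -- the block `zblk k` is an `m`-set whose power sum vanishes on the first `R'` coordinates: not generic
  obtain ⟨r, hrR, hr⟩ := hα m hm1 hmL (zblk ℓ S Z k) (hcard k)
  apply hr
  have := hk ⟨r.val, hrR⟩
  rw [pcol_sum] at this
  exact this

end Escape

/-! #### (4) GENERIC ELEMENTS EXIST (counting) -/
section Generic
variable (p : ℕ) [hp : Fact p.Prime]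

/-- the power-sum polynomial of a set of exponents: `Q_B = Σ_{i∈B} X^(i+1)`. -/
noncomputable def psPoly (n : ℕ) (B : Finset (Fin n)) : (GaloisField p (rk n))[X] := ∑ i ∈ B, X ^ (i.val + 1)

/-- its value at `α` is the power sum. -/
theorem psPoly_eval (n : ℕ) (B : Finset (Fin n)) (α : GaloisField p (rk n)) :
    (psPoly p n B).eval α = ∑ i ∈ B, α ^ (i.val + 1) := by
  unfold psPoly
  rw [eval_finsetSum]
  simp

/-- its degree is at most `n`. -/
theorem psPoly_natDegree_le (n : ℕ) (B : Finset (Fin n)) : (psPoly p n B).natDegree ≤ n := by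
  unfold psPoly
  apply natDegree_sum_le_of_forall_le
  intro i _
  rw [natDegree_X_pow]
  omega

/-- for non-empty `B`, `Q_B − C v` is a non-zero polynomial (its top coefficient is `1`). -/
theorem psPoly_sub_C_ne_zero (n : ℕ) (B : Finset (Fin n)) (hB : B.Nonempty) (v : GaloisField p (rk n)) :
    psPoly p n B - C v ≠ 0 := by
  classical
  intro h0
  set i₀ : Fin n := B.max' hB with hi₀
  have hc : (psPoly p n B - C v).coeff (i₀.val + 1) = 1 := by
    rw [coeff_sub, coeff_C, if_neg (Nat.succ_ne_zero _), sub_zero]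
    unfold psPoly
    rw [finsetSum_coeff]
    simp only [coeff_X_pow]
    rw [Finset.sum_eq_single i₀]
    · simp
    · intro j hj hne
      rw [if_neg]
      intro he
      apply hne
      ext
      omega
    · intro h
      exact absurd (B.max'_mem hB) (hi₀ ▸ h)
  rw [h0, coeff_zero] at hc
  exact zero_ne_one hc

/-- at most `n` elements `α` have power sum over `B ≠ ∅` equal to a given `v`. -/
theorem card_powerSum_eq_le (n : ℕ) [Fintype (GaloisField p (rk n))] [DecidableEq (GaloisField p (rk n))]
    (B : Finset (Fin n)) (hB : B.Nonempty) (v : GaloisField p (rk n)) :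
    (univ.filter fun α : GaloisField p (rk n) => ∑ i ∈ B, α ^ (i.val + 1) = v).card ≤ n := by
  classical
  set P : (GaloisField p (rk n))[X] := psPoly p n B - C v with hP
  have hP0 : P ≠ 0 := psPoly_sub_C_ne_zero p n B hB v
  have hsub : (univ.filter fun α : GaloisField p (rk n) => ∑ i ∈ B, α ^ (i.val + 1) = v) ⊆ P.roots.toFinset := by
    intro α hα
    rw [Multiset.mem_toFinset, mem_roots hP0, IsRoot.def, hP, eval_sub, eval_C, psPoly_eval, (mem_filter.1 hα).2, sub_self]
  have h1 := card_le_card hsub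
  have h2 : P.roots.toFinset.card ≤ P.roots.card := Multiset.toFinset_card_le _
  have h3 : P.roots.card ≤ P.natDegree := card_roots' P
  have h4 : P.natDegree ≤ n := by
    rw [hP]
    exact le_trans (natDegree_sub_le _ _) (max_le (psPoly_natDegree_le p n B) (by rw [natDegree_C]; exact Nat.zero_le _))
  omega

/-- the elements with vanishing coordinates `r < R'` number at most `p^(R − R')`. -/
theorem card_lowZero_le (n : ℕ) [Fintype (GaloisField p (rk n))] [DecidableEq (GaloisField p (rk n))]
    (R' : ℕ) (hR' : R' ≤ rk n) :
    (univ.filter fun v : GaloisField p (rk n) => ∀ r : Fin (rk n), r.val < R' → coord p n v r = 0).card ≤ p ^ (rk n - R') := by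
  classical
  set V := (univ.filter fun v : GaloisField p (rk n) => ∀ r : Fin (rk n), r.val < R' → coord p n v r = 0) with hV
  let f : GaloisField p (rk n) → (Fin (rk n - R') → ZMod p) := fun v j => coord p n v ⟨R' + j.val, by omega⟩
  have hinj : Set.InjOn f ↑V := by
    intro v hv w hw hvw
    have hv' := (mem_filter.1 (Finset.mem_coe.1 hv)).2
    have hw' := (mem_filter.1 (Finset.mem_coe.1 hw)).2
    apply eq_of_coord_eq p n
    intro r
    by_cases hr : r.val < R'
    · rw [hv' r hr, hw' r hr]
    · have := congrFun hvw ⟨r.val - R', by omega⟩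
      have e : (⟨R' + (r.val - R'), by omega⟩ : Fin (rk n)) = r := by ext; simp; omega
      simpa [f, e] using this
  have h1 : V.card ≤ (univ : Finset (Fin (rk n - R') → ZMod p)).card :=
    Finset.card_le_card_of_injOn f (fun v _ => mem_univ _) hinj
  rw [card_univ, Fintype.card_fun, ZMod.card, Fintype.card_fin] at h1
  exact h1

omit hp in
/-- the arithmetic of the count: `L · n^(m+1) · p^(R − (m+1)(L+1)) < p^R` for `p ≥ 4`, `m ≤ L = log₂ n`. -/
theorem count_lt (n : ℕ) (h4 : 4 ≤ p) (m : ℕ) (hm : m ≤ Nat.log 2 n) :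
    Nat.log 2 n * (n ^ (m + 1) * p ^ (rk n - (m + 1) * (Nat.log 2 n + 1))) < p ^ rk n := by
  set L := Nat.log 2 n with hL
  set R' := (m + 1) * (L + 1) with hR'
  have hR'le : R' ≤ rk n := by
    show (m + 1) * (L + 1) ≤ (Nat.log 2 n + 1) ^ 2
    rw [← hL, sq]; exact Nat.mul_le_mul_right _ (by omega)
  have hsplit : p ^ rk n = p ^ R' * p ^ (rk n - R') := by rw [← pow_add]; congr 1; omega
  rw [hsplit]
  have hpos : 0 < p ^ (rk n - R') := by positivity
  suffices h : L * n ^ (m + 1) < p ^ R' by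
    calc L * (n ^ (m + 1) * p ^ (rk n - R')) = (L * n ^ (m + 1)) * p ^ (rk n - R') := by ring
      _ < p ^ R' * p ^ (rk n - R') := Nat.mul_lt_mul_of_pos_right h hpos
  -- `n < 2^(L+1)`, `L < 2^(R')`, `p^R' ≥ 4^R' = 2^R' · 2^R'`
  have hn : n < 2 ^ (L + 1) := Nat.lt_pow_succ_log_self (by norm_num) n
  have h1 : n ^ (m + 1) ≤ (2 ^ (L + 1)) ^ (m + 1) := Nat.pow_le_pow_left hn.le _
  have h2 : (2 ^ (L + 1)) ^ (m + 1) = 2 ^ R' := by rw [← pow_mul, hR', mul_comm]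
  have h3 : L < 2 ^ R' := by
    have : L < 2 ^ L := Nat.lt_two_pow_self
    have : 2 ^ L ≤ 2 ^ R' := Nat.pow_le_pow_right (by norm_num) (by rw [hR']; nlinarith)
    omega
  have h4' : 2 ^ R' * 2 ^ R' ≤ p ^ R' := by
    rw [← mul_pow]; exact Nat.pow_le_pow_left (by omega) _
  calc L * n ^ (m + 1) ≤ L * 2 ^ R' := by rw [← h2]; exact Nat.mul_le_mul_left _ h1
    _ < 2 ^ R' * 2 ^ R' := Nat.mul_lt_mul_of_pos_right h3 (by positivity)
    _ ≤ p ^ R' := h4'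

/-- ★ **GENERIC ELEMENTS EXIST** (`p ≥ 4`; counting): some `α ∈ GaloisField p (rk n)` has, for every `m`-set of exponents with
`1 ≤ m ≤ log₂ n`, a power sum with a non-zero coordinate of index `< (m+1)(log₂ n + 1)`. -/
theorem exists_generic (n : ℕ) (h4 : 4 ≤ p) :
    ∃ α : GaloisField p (rk n), ∀ m : ℕ, 1 ≤ m → m ≤ Nat.log 2 n → ∀ B : Finset (Fin n), B.card = m →
      ∃ r : Fin (rk n), r.val < (m + 1) * (Nat.log 2 n + 1) ∧ coord p n (∑ i ∈ B, α ^ (i.val + 1)) r ≠ 0 := by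
  classical
  haveI : Fintype (GaloisField p (rk n)) := Fintype.ofFinite _
  set F := GaloisField p (rk n) with hF
  set L := Nat.log 2 n with hL
  by_contra hnot
  push Not at hnot
  -- bad sets
  let R' : ℕ → ℕ := fun m => (m + 1) * (L + 1)
  let V : ℕ → Finset F := fun m => univ.filter fun v : F => ∀ r : Fin (rk n), r.val < R' m → coord p n v r = 0
  let Sset : ℕ → Finset (Fin n) → Finset F := fun m B =>
    (V m).biUnion fun v => univ.filter fun α : F => ∑ i ∈ B, α ^ (i.val + 1) = v
  have hcover : (univ : Finset F) ⊆ (Finset.Icc 1 L).biUnion fun m => (univ.powersetCard m).biUnion fun B => Sset m B := by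
    intro α _
    obtain ⟨m, hm1, hmL, B, hB, hzero⟩ := hnot α
    rw [Finset.mem_biUnion]
    refine ⟨m, Finset.mem_Icc.2 ⟨hm1, hmL⟩, ?_⟩
    rw [Finset.mem_biUnion]
    refine ⟨B, Finset.mem_powersetCard.2 ⟨subset_univ _, hB⟩, ?_⟩
    rw [Finset.mem_biUnion]
    refine ⟨∑ i ∈ B, α ^ (i.val + 1), ?_, ?_⟩
    · rw [mem_filter]
      exact ⟨mem_univ _, fun r hr => by
        by_contra hne
        exact absurd (hzero r hr) hne⟩
    · rw [mem_filter]; exact ⟨mem_univ _, rfl⟩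
  -- card of each bad set
  have hS : ∀ m, 1 ≤ m → m ≤ L → ∀ B : Finset (Fin n), B.card = m → (Sset m B).card ≤ p ^ (rk n - R' m) * n := by
    intro m hm1 hmL B hB
    have hBne : B.Nonempty := by rw [← Finset.card_pos]; omega
    have hR'le : R' m ≤ rk n := by
      show (m + 1) * (L + 1) ≤ (Nat.log 2 n + 1) ^ 2
      rw [← hL, sq]; exact Nat.mul_le_mul_right _ (by omega)
    calc (Sset m B).card ≤ ∑ v ∈ V m, (univ.filter fun α : F => ∑ i ∈ B, α ^ (i.val + 1) = v).card := card_biUnion_le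
      _ ≤ ∑ _v ∈ V m, n := Finset.sum_le_sum fun v _ => card_powerSum_eq_le p n B hBne v
      _ = (V m).card * n := by simp
      _ ≤ p ^ (rk n - R' m) * n := Nat.mul_le_mul_right _ (card_lowZero_le p n (R' m) hR'le)
  -- total
  have htotal : (univ : Finset F).card ≤ ∑ m ∈ Finset.Icc 1 L, (n ^ m * (p ^ (rk n - R' m) * n)) := by
    refine le_trans (card_le_card hcover) (le_trans card_biUnion_le (Finset.sum_le_sum fun m hm => ?_))
    have hm := Finset.mem_Icc.1 hm
    refine le_trans card_biUnion_le ?_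
    calc ∑ B ∈ univ.powersetCard m, (Sset m B).card
        ≤ ∑ _B ∈ (univ : Finset (Fin n)).powersetCard m, p ^ (rk n - R' m) * n :=
          Finset.sum_le_sum fun B hB => hS m hm.1 hm.2 B (Finset.mem_powersetCard.1 hB).2
      _ = (n.choose m) * (p ^ (rk n - R' m) * n) := by
          rw [Finset.sum_const, Finset.card_powersetCard, card_univ, Fintype.card_fin, smul_eq_mul]
      _ ≤ n ^ m * (p ^ (rk n - R' m) * n) := Nat.mul_le_mul_right _ (Nat.choose_le_pow n m)
  have hcardF : (univ : Finset F).card = p ^ rk n := by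
    rw [card_univ, ← Nat.card_eq_fintype_card]
    exact GaloisField.card p (rk n) (rk_ne_zero n)
  rw [hcardF] at htotal
  -- each term is `< p^R / L`-ish: `L · term < p^R`
  have hterm : ∀ m ∈ Finset.Icc 1 L, n ^ m * (p ^ (rk n - R' m) * n) ≤ (p ^ rk n - 1) / L := by
    intro m hm
    have hm' := Finset.mem_Icc.1 hm
    have hlt := count_lt p n h4 m hm'.2
    rw [← hL] at hlt
    have e : n ^ m * (p ^ (rk n - R' m) * n) = n ^ (m + 1) * p ^ (rk n - (m + 1) * (L + 1)) := by
      show n ^ m * (p ^ (rk n - (m + 1) * (L + 1)) * n) = _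
      rw [pow_succ]; ring
    rw [e]
    have hLpos : 0 < L := by omega
    rw [Nat.le_div_iff_mul_le hLpos]
    have : n ^ (m + 1) * p ^ (rk n - (m + 1) * (L + 1)) * L < p ^ rk n := by rw [mul_comm]; exact hlt
    omega
  have hsum : ∑ m ∈ Finset.Icc 1 L, n ^ m * (p ^ (rk n - R' m) * n) ≤ L * ((p ^ rk n - 1) / L) := by
    calc ∑ m ∈ Finset.Icc 1 L, n ^ m * (p ^ (rk n - R' m) * n) ≤ ∑ _m ∈ Finset.Icc 1 L, (p ^ rk n - 1) / L :=
          Finset.sum_le_sum hterm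
      _ = L * ((p ^ rk n - 1) / L) := by simp
  have hdiv : L * ((p ^ rk n - 1) / L) ≤ p ^ rk n - 1 := Nat.mul_div_le _ _
  have hpR : 0 < p ^ rk n := by have := hp.out.pos; positivity
  -- if `L = 0` the cover is empty: `p^R ≤ 0`, absurd; else `p^R ≤ p^R − 1`, absurd
  omega

/-- ★★ **`fieldY` ROBUSTLY ESCAPES THE MASK DIAL** (primes `p ≥ 5`, every `n` with `3·p·rk n ≤ n`): for a suitable `α`, NO
presentation of `fieldY p n α` with juntas `≤ log₂ n` meets the inlined mask-dial hypothesis — hence none meets the null- or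
block-dial hypotheses either (parts 31E/31C: block ⊆ null ⊆ mask for `3 ∤ p`). -/
theorem fieldY_not_mask (n : ℕ) (h5 : 5 ≤ p) (hn : 3 * p * (rk n + 1) ≤ n) :
    ∃ α : GaloisField p (rk n), ∀ D : JLinData p n, D.strat = fieldY p n α → (∀ g, (D.J g).card ≤ Nat.log 2 n) →
    ¬ (∃ (ℓ m M : ℕ) (S : Fin M → ℕ) (Z : Finset (Fin n)), (m % 3 = 1 ∨ m % 3 = 2) ∧
        ((∀ k k' : Fin M, k < k' → S k + ℓ ≤ S k') ∧ (∀ k : Fin M, S k + ℓ ≤ n)) ∧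
        (∀ k : Fin M, (zblk ℓ S Z k).card = m) ∧
        2 ^ m * ((Nat.log 2 n + 1) * (Nat.log 2 n + 1) + 1) ≤ M ∧
          ∀ g (k : Fin M), ∑ i ∈ zblk ℓ S Z k, D.a g i = 0) := by
  obtain ⟨α, hα⟩ := exists_generic p n (by omega)
  exact ⟨α, fun D hD hJ => field_not_mask p n hn α hα D hD hJ⟩


omit hp in
/-- the size condition `3·p·(R+1) ≤ n` holds for all large `n`. -/
theorem eventually_fits : ∃ n₀ : ℕ, ∀ n ≥ n₀, 3 * p * (rk n + 1) ≤ n := by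
  obtain ⟨N₀, hN₀⟩ := DWalk.const_mul_logPow_le' (15 * p) 2
  refine ⟨max N₀ 2, fun n hn => ?_⟩
  have h1 := hN₀ n (le_trans (le_max_left _ _) hn)
  have hL : 1 ≤ Nat.log 2 n := Nat.log_pos (by norm_num) (by have := le_trans (le_max_right _ _) hn; omega)
  unfold rk
  have h2 : (Nat.log 2 n + 1) ^ 2 + 1 ≤ 5 * Nat.log 2 n ^ 2 := by nlinarith
  have h3 : 3 * p * ((Nat.log 2 n + 1) ^ 2 + 1) ≤ 3 * p * (5 * Nat.log 2 n ^ 2) := Nat.mul_le_mul_left _ h2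
  have h4 : 3 * p * (5 * Nat.log 2 n ^ 2) = 15 * p * Nat.log 2 n ^ 2 := by ring
  omega

/-- ★★ **EVENTUAL FORM**: for every prime `p ≥ 5` there is `n₀` such that for every `n ≥ n₀` some member `fieldY p n α` of the family —
a junta-free ⊕ one-form strategy (`fieldData`) — has NO `log₂ n`-junta presentation meeting the mask-dial hypothesis. -/
theorem fieldY_not_mask_eventually (h5 : 5 ≤ p) : ∃ n₀ : ℕ, ∀ n ≥ n₀, ∃ α : GaloisField p (rk n),
    (fieldData p n α).strat = fieldY p n α ∧ (∀ g, ((fieldData p n α).J g).card ≤ Nat.log 2 n) ∧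
    ∀ D : JLinData p n, D.strat = fieldY p n α → (∀ g, (D.J g).card ≤ Nat.log 2 n) →
    ¬ (∃ (ℓ m M : ℕ) (S : Fin M → ℕ) (Z : Finset (Fin n)), (m % 3 = 1 ∨ m % 3 = 2) ∧
        ((∀ k k' : Fin M, k < k' → S k + ℓ ≤ S k') ∧ (∀ k : Fin M, S k + ℓ ≤ n)) ∧
        (∀ k : Fin M, (zblk ℓ S Z k).card = m) ∧
        2 ^ m * ((Nat.log 2 n + 1) * (Nat.log 2 n + 1) + 1) ≤ M ∧
          ∀ g (k : Fin M), ∑ i ∈ zblk ℓ S Z k, D.a g i = 0) := by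
  obtain ⟨n₀, hn₀⟩ := eventually_fits p
  refine ⟨n₀, fun n hn => ?_⟩
  obtain ⟨α, hα⟩ := fieldY_not_mask p n h5 (hn₀ n hn)
  exact ⟨α, fieldData_strat p n α, fun g => by rw [fieldData_J]; simp, hα⟩

end Generic

end Summit.QuantumAdvantage.AdviceFreeQNC0.JLinPeel.FieldCol
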